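import Summits.Schanuel.Schanuel.Theorems.RootDecomp1KCollarWall03

/-!
# RootDecomp1KCollarWall — lens 1, generation 49, node 8 «THE COLLAR WALL: item 33364 decided hyp-free at the exhibited fixed-finite-order tuple z♮₃ = (1, ℓ₂, ρ♮₂) and its π-twin, via a class-level wall engine for DyadicCollarLiouville against any θ⃗ with MvPolyMeasure» — continuation (RootDecomp1KCollarWall04): §4a the member: the one-cut 2-adic linear-form bound

(lens-1 g49 HOME kernel K = HOME/decomp-schanuel-lens-1/g49/CollarWall.lean 402bd26b…, 1041 l, imports …RootDecomp1KCollarCell05 + …RootDecomp1KNWMeasureHolds BY NAME; P CollarWallProbe.lean / C CollarWallCtrl.lean; memo NODE-g49.md; CLAIM L2443, EX-ANTE PRICE + CHECKLIST K-g49 L2444, NODE L2450 / REQUEST L2451; critic VERDICT L2454: CLEARED AS PRICED — ONE CELL ×1 «COLLAR WALL», RULE K-R38, PORT GO. Port by census-1 gen 21 as `RootDecomp1KCollarWall01–05` along K's §1–§4 with §4 cut at its §4a/§4b sub-headers by the 400-line file cap: 01 = §1 (W1) `mvMaxval₂`, `clearPoly_ne_zero_of_twoAdic` — T1 in the `clearPoly`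 frame (the cleared θ-polynomial at 2-adically interlaced slots is ≠ 0); 02 = §2 (W2) `collar_balance_false` + (W3) **`algebraicIndependent_collar_of_mvPolyMeasure (hρ : DyadicCollarLiouville ρ) (hθ : MvPolyMeasure θ)`** — the COLLAR WALL ENGINE (resonant-height simultaneous specialisation against a transcendental block of polynomial measure); 03 = §3 (W4) the walls for the WHOLE class, hyp-free: `sb_collarWall3`, `sb_collarWall3_pi`, `finiteOrderLiouvilleSchanuel_collarWall3` (item 33364's binders verbatim + one range line), `finiteOrderLiouvilleSchanuel_collarWall3_pi`, `coordLiouvilleSchanuel_collarWall3`; 04 = §4a the ONE-CUT 2-adic linear-form bound at the member: `cutInt`, `cutInt_ne_zero`, `cut_height_bound`, **`form_lower_bound_N`**; 05 = §4b the tuples `zN3 = (1, ℓ₂, ρ♮₂)` / `zN3pi` with every binder of item 33364 certified hyp-free: `linearIndependent_zN3(pi)`, `linLiouville_zN3(pi)`, `not_hyperLinLiouville_zN3(pi)`, `sb_zN3` / `sb_zN3pi`, `finiteOrderLiouvilleSchanuel_at_zN3(pi)`, `item33364_at_zN3`, `rhoNat_two_position`. PORT EDITS (census convention): `set_option linter.dupNamespace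 false` dropped; per-part private helper copies if any; statements and proofs otherwise verbatim (no renames; K's own private markers kept). `--supports stmt-Schanuel-33364`; no census credit carried; rung 0 — nothing here proves Schanuel; no ∀-item moves; 33364, 33363, 31077 stay OPEN.)
-/

noncomputable section

open Polynomial LiouvilleNumber
open scoped Nat

namespace Summit.Schanuel.Schanuel.Theorems.RootDecomp1KCollarWall

open Summit.Schanuel.Schanuel.Theorems.RootDecomp1KCollarCell
open Summit.Schanuel.Schanuel.Theorems.RootDecomp1KGapCell
open Summit.Schanuel.Schanuel.Theorems.RootDecomp1KTwoBaseCell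
open Summit.Schanuel.Schanuel.Theorems.RootDecomp1KRelLiouvilleCell
open Summit.Schanuel.Schanuel.Theorems.RootDecomp1KNWMeasureHolds (nwMeasure_holds polyMeasure_exp_one_holds)
open Summit.Schanuel.Schanuel.Theorems.RootDecomp1KHyper
open Summit.Schanuel.Schanuel.Theorems.RootDecomp1KHyper.HyperCell

/-! ## §4  THE MEMBERS `z♮₃ = (1, ℓ₂, ρ♮₂)`, `z♮₃^π = (π, πℓ₂, πρ♮₂)` — every binder of item 33364 CERTIFIED, hyp-free

`ρ♮₂ = rhoNat 2` is g48's collar member of EXACT Skel-order `2` (tree CollarCell03–05: `Nn 2 k = 6 + 2k`,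
`f_k = N_k! + N_k`, `g_k = 2(N_k+1)f_k + 1`, truncations `t_k = M_k/2^{f_k}` with `M_k` odd, tails `∈ (2^{−g_k}, 2·2^{−g_k})`). -/
section Members

open IntermediateField

/-! ### §4a  the 2-adic cut (ONE CUT at `F = (N_K+1)!`) and the form lower bound -/

/-- `2·f_k ≤ (N_k+1)!`: the `ℓ₂`-cut `F = (N_k+1)!` leaves the room `F − f_k ≥ f_k` above the `ρ♮`-resolution `2^{f_k}`. -/
theorem two_mul_fN_le_factorial_succ (m k : ℕ) : 2 * fN m k ≤ (Nn m k + 1)! := by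
  have hN4 : 4 ≤ Nn m k := le_trans (Nat.le_add_left 4 m) (le_Nn m k)
  have hNf : Nn m k ≤ (Nn m k)! := Nat.self_le_factorial _
  have h4 := Nat.mul_le_mul_right (Nn m k)! hN4
  unfold fN
  rw [Nat.factorial_succ]
  nlinarith [h4, hNf]

/-- Slack of the `ℓ₂`-tail above the cut: `f_k + (N_k+1)! + 3 ≤ (N_k+2)!`. -/
theorem cut_slack_ell (m k : ℕ) : fN m k + (Nn m k + 1)! + 3 ≤ (Nn m k + 1 + 1)! := by
  have h2f := two_mul_fN_le_factorial_succ m k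
  have hN4 : 4 ≤ Nn m k := le_trans (Nat.le_add_left 4 m) (le_Nn m k)
  have hf4 : 4 ≤ fN m k := le_trans hN4 (Nn_le_fN m k)
  have h3 := Nat.mul_le_mul_right (Nn m k + 1)! (show 3 ≤ Nn m k + 1 + 1 by omega)
  rw [Nat.factorial_succ (Nn m k + 1)]
  omega

/-- Slack of the `ρ♮_m`-tail above the cut (`m ≥ 2`): `f_k + (N_k+1)! + 3 ≤ g_k`. -/
theorem cut_slack_rho {m : ℕ} (hm : 2 ≤ m) (k : ℕ) : fN m k + (Nn m k + 1)! + 3 ≤ gN m k := by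
  have hN4 : 4 ≤ Nn m k := le_trans (Nat.le_add_left 4 m) (le_Nn m k)
  have hf4 : 4 ≤ fN m k := le_trans hN4 (Nn_le_fN m k)
  have h1 : (Nn m k + 1)! ≤ (Nn m k + 1) * fN m k := by
    rw [Nat.factorial_succ]; exact Nat.mul_le_mul_left _ (factorial_lt_fN m k).le
  have h2 : 2 * ((Nn m k + 1) * fN m k) ≤ m * (Nn m k + 1) * fN m k := by
    rw [mul_assoc]; exact Nat.mul_le_mul_right _ hm
  have h3 : 5 * fN m k ≤ (Nn m k + 1) * fN m k := Nat.mul_le_mul_right _ (by omega)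
  unfold gN
  omega

/-- **The 2-adic cut never vanishes** (pure 2-adic divisibility): `I = g₀·2^{c+f} + g₁·p + g₂·M·2^c` with `p`, `M` ODD,
`|g₁| < 2^c`, `|g₂| < 2^f` and `(g₀, g₁, g₂) ≠ 0` is a non-zero integer — `2^c ∣ g₁ p` forces `g₁ = 0`, then
`2^f ∣ g₂ M` forces `g₂ = 0`, then `g₀ = 0`. -/
theorem cutInt_ne_zero {g₀ g₁ g₂ p M : ℤ} {c f : ℕ} (hp : Odd p) (hM : Odd M)
    (h1 : |g₁| < 2 ^ c) (h2 : |g₂| < 2 ^ f) (hg : ¬ (g₀ = 0 ∧ g₁ = 0 ∧ g₂ = 0)) :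
    g₀ * 2 ^ (c + f) + g₁ * p + g₂ * M * 2 ^ c ≠ 0 := by
  intro hI
  have hcop2 : ∀ {q : ℤ}, Odd q → ∀ k : ℕ, IsCoprime ((2 : ℤ) ^ k) q := by
    intro q hq k
    obtain ⟨j, hj⟩ := hq
    have h2q : IsCoprime (2 : ℤ) q := ⟨-j, 1, by rw [hj]; ring⟩
    exact h2q.pow_left
  -- step 1: `2^c ∣ g₁·p`, hence `2^c ∣ g₁`, hence `g₁ = 0`
  have hd1 : (2 : ℤ) ^ c ∣ g₁ * p := by
    refine ⟨-(g₀ * 2 ^ f + g₂ * M), ?_⟩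
    rw [pow_add] at hI
    linear_combination hI
  have hg1 : g₁ = 0 := Int.eq_zero_of_abs_lt_dvd ((hcop2 hp c).dvd_of_dvd_mul_right hd1) h1
  -- step 2: `g₀·2^f + g₂·M = 0`, hence `2^f ∣ g₂`, hence `g₂ = 0`, hence `g₀ = 0`
  have hI2 : g₀ * 2 ^ f + g₂ * M = 0 := by
    have h2c : (2 : ℤ) ^ c ≠ 0 := pow_ne_zero _ two_ne_zero
    have h3 : (g₀ * 2 ^ f + g₂ * M) * 2 ^ c = 0 := by
      rw [hg1, pow_add] at hI
      linear_combination hI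
    exact (mul_eq_zero.mp h3).resolve_right h2c
  have hd2 : (2 : ℤ) ^ f ∣ g₂ * M := ⟨-g₀, by linear_combination hI2⟩
  have hg2 : g₂ = 0 := Int.eq_zero_of_abs_lt_dvd ((hcop2 hM f).dvd_of_dvd_mul_right hd2) h2
  have hg0 : g₀ = 0 := by
    rw [hg2, zero_mul, add_zero] at hI2
    exact (mul_eq_zero.mp hI2).resolve_right (pow_ne_zero _ two_ne_zero)
  exact hg ⟨hg0, hg1, hg2⟩

/-- The integer skeleton of a form `g₀ + g₁ℓ₂ + g₂ρ♮₂` at the cut `K` (resolution `2^{(N_K+1)!}`):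
`I_K(g) = g₀·2^{(N_K+1)!} + g₁·p_{N_K+1} + g₂·M_K·2^{(N_K+1)! − f_K}` (`p_N` = tree `psNumer 2 N`, `M_K` = tree `MN 2 K`). -/
def cutInt (g : Fin 3 → ℤ) (K : ℕ) : ℤ :=
  g 0 * 2 ^ (Nn 2 K + 1)! + g 1 * (psNumer 2 (Nn 2 K + 1) : ℤ) + g 2 * MN 2 K * 2 ^ ((Nn 2 K + 1)! - fN 2 K)

/-- The cut is the dyadic rational `I_K(g) / 2^{(N_K+1)!}`: `g₀ + g₁ s_{N_K+1} + g₂ t_K = I_K(g)/2^{(N_K+1)!}`. -/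
theorem cut_eq (g : Fin 3 → ℤ) (K : ℕ) :
    (g 0 : ℝ) + g 1 * partialSum 2 (Nn 2 K + 1) + g 2 * ((tN 2 K : ℚ) : ℝ) =
      (cutInt g K : ℝ) / (2 : ℝ) ^ (Nn 2 K + 1)! := by
  have hp : partialSum 2 (Nn 2 K + 1) = (psNumer 2 (Nn 2 K + 1) : ℝ) / 2 ^ (Nn 2 K + 1)! := by
    have := partialSum_eq_psNumer_div (by norm_num : 0 < 2) (Nn 2 K + 1)
    push_cast at this
    exact this
  rw [hp, tN_cast, cutInt]
  push_cast
  rw [pow_sub₀ _ two_ne_zero (fN_le_factorial_succ 2 K)]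
  field_simp

/-- **`I_K(g) ≠ 0`** whenever `g ≠ 0` and `|g₁|, |g₂| < 2^{f_K}` (by `cutInt_ne_zero`: `p_{N_K+1}` odd — tree
`odd_psNumer_two`; `M_K` odd — tree `MN_odd`; and `f_K ≤ (N_K+1)! − f_K` — `two_mul_fN_le_factorial_succ`). -/
theorem cutInt_ne_zero_of_small (g : Fin 3 → ℤ) (K : ℕ) (hg : g ≠ 0) (h1 : |g 1| < 2 ^ fN 2 K)
    (h2 : |g 2| < 2 ^ fN 2 K) : cutInt g K ≠ 0 := by
  have hfF : fN 2 K ≤ (Nn 2 K + 1)! := fN_le_factorial_succ 2 K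
  have h2f : 2 * fN 2 K ≤ (Nn 2 K + 1)! := two_mul_fN_le_factorial_succ 2 K
  set c : ℕ := (Nn 2 K + 1)! - fN 2 K with hc
  have hF : (Nn 2 K + 1)! = c + fN 2 K := by omega
  have hfc : fN 2 K ≤ c := by omega
  have h1' : |g 1| < 2 ^ c := lt_of_lt_of_le h1 (pow_le_pow_right₀ (by norm_num) hfc)
  have hg' : ¬ (g 0 = 0 ∧ g 1 = 0 ∧ g 2 = 0) := by
    rintro ⟨h0, h1, h2⟩; apply hg; funext i; fin_cases i <;> simp [h0, h1, h2]
  have hN2 : 2 ≤ Nn 2 K + 1 := by have := le_Nn 2 K; omega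
  have key := cutInt_ne_zero (hp := odd_psNumer_two hN2) (hM := MN_odd 2 K) (g₀ := g 0) h1' h2 hg'
  rw [cutInt, hF, Nat.add_sub_cancel]
  exact key

/-- A non-vanishing cut is `≥` its resolution: `I_K(g) ≠ 0 ⇒ 2^{−(N_K+1)!} ≤ |g₀ + g₁ s_{N_K+1} + g₂ t_K|`. -/
theorem cut_lower (g : Fin 3 → ℤ) (K : ℕ) (hne : cutInt g K ≠ 0) :
    1 / (2 : ℝ) ^ (Nn 2 K + 1)! ≤ |(g 0 : ℝ) + g 1 * partialSum 2 (Nn 2 K + 1) + g 2 * ((tN 2 K : ℚ) : ℝ)| := by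
  rw [cut_eq, abs_div, abs_of_pos (by positivity : (0 : ℝ) < 2 ^ (Nn 2 K + 1)!)]
  exact div_le_div_of_nonneg_right (by exact_mod_cast Int.one_le_abs hne) (by positivity)

/-- The cut's truncation error: `|φ(g) − Φ_K(g)| ≤ |g₁|·2/2^{(N_K+2)!} + |g₂|·2/2^{g_K}` (tree
`abs_liouvilleNumber_two_sub_partialSum`, `rhoNat_eq_tN_add_tailN`, `tailN_lt_two_div`). -/
theorem cut_approx (g : Fin 3 → ℤ) (K : ℕ) :
    |((g 0 : ℝ) + g 1 * liouvilleNumber 2 + g 2 * rhoNat 2) -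
      ((g 0 : ℝ) + g 1 * partialSum 2 (Nn 2 K + 1) + g 2 * ((tN 2 K : ℚ) : ℝ))| ≤
      |(g 1 : ℝ)| * (2 / (2 : ℝ) ^ (Nn 2 K + 1 + 1)!) + |(g 2 : ℝ)| * (2 / (2 : ℝ) ^ gN 2 K) := by
  have hW := rhoNat_eq_tN_add_tailN (m := 2) (by norm_num) K
  have tpos := tailN_pos (m := 2) (by norm_num) K
  have tlt := tailN_lt_two_div (m := 2) (by norm_num) K
  have hr := abs_liouvilleNumber_two_sub_partialSum (Nn 2 K + 1)
  have e : ((g 0 : ℝ) + g 1 * liouvilleNumber 2 + g 2 * rhoNat 2) -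
      ((g 0 : ℝ) + g 1 * partialSum 2 (Nn 2 K + 1) + g 2 * ((tN 2 K : ℚ) : ℝ)) =
      g 1 * (liouvilleNumber 2 - partialSum 2 (Nn 2 K + 1)) + g 2 * tailN 2 K := by rw [hW]; ring
  rw [e]
  calc |(g 1 : ℝ) * (liouvilleNumber 2 - partialSum 2 (Nn 2 K + 1)) + g 2 * tailN 2 K|
      ≤ |(g 1 : ℝ)| * |liouvilleNumber 2 - partialSum 2 (Nn 2 K + 1)| + |(g 2 : ℝ)| * tailN 2 K := by
        refine (abs_add_le _ _).trans ?_
        rw [abs_mul, abs_mul, abs_of_pos tpos]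
    _ ≤ |(g 1 : ℝ)| * (2 / (2 : ℝ) ^ (Nn 2 K + 1 + 1)!) + |(g 2 : ℝ)| * (2 / (2 : ℝ) ^ gN 2 K) := by
        gcongr

/-- **Minimality of the scale bounds the resolution by the height**: if `2^{f_k} ≤ H` for every `k < K` (i.e. `K` is
the LEAST scale with `H < 2^{f_K}`) then `(N_K+1)! + 1 ≤ (1+H)^{13}` — for `K = 0` this is `5041 ≤ (1+H)^{13}` (`N_0 = 6`,
`7! = 5040` by `decide`-free `norm_num [Nat.factorial]`, and `2^{13} = 8192`); for `K ≥ 1`, `f_{K−1} < 2^{f_{K−1}} ≤ H` gives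
`(N_K+1)! + 1 = (N'+3)! + 1 ≤ (2(1+H))³·H + 1 ≤ 8(1+H)⁴ ≤ (1+H)^7` with `N' = N_{K−1} < H`, `N'! ≤ H`. -/
theorem cut_height_bound {H K : ℕ} (hH : 1 ≤ H) (hmin : ∀ k < K, 2 ^ fN 2 k ≤ H) :
    (Nn 2 K + 1)! + 1 ≤ (1 + H) ^ 13 := by
  have X2 : 2 ≤ 1 + H := by omega
  rcases Nat.eq_zero_or_pos K with hz | hpos
  · subst hz
    have h7 : (Nn 2 0 + 1)! = 5040 := by norm_num [Nn, Nat.factorial]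
    have h13 : 2 ^ 13 ≤ (1 + H) ^ 13 := Nat.pow_le_pow_left X2 13
    rw [h7]
    norm_num at h13
    omega
  · have hm := hmin (K - 1) (by omega)
    set N' : ℕ := Nn 2 (K - 1) with hN'
    have hNK : Nn 2 K = N' + 2 := by rw [hN']; unfold Nn; omega
    have hf' : fN 2 (K - 1) < H := lt_of_lt_of_le Nat.lt_two_pow_self hm
    have hfac' : N' ! < fN 2 (K - 1) := factorial_lt_fN 2 (K - 1)
    have hN'le : N' ≤ fN 2 (K - 1) := Nn_le_fN 2 (K - 1)
    have hA : N' ! ≤ H := by omega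
    have hexp : (N' + 3)! = (N' + 3) * ((N' + 2) * ((N' + 1) * N' !)) := by
      rw [show N' + 3 = (N' + 2) + 1 by rfl, Nat.factorial_succ, show N' + 2 = (N' + 1) + 1 by rfl,
        Nat.factorial_succ, Nat.factorial_succ]
    rw [hNK, show N' + 2 + 1 = N' + 3 by rfl]
    have hcube : 1 ≤ (1 + H) ^ 3 := Nat.one_le_pow _ _ (by omega)
    have h8 : 8 ≤ (1 + H) ^ 3 := by
      calc 8 = 2 ^ 3 := by norm_num
        _ ≤ (1 + H) ^ 3 := Nat.pow_le_pow_left X2 3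
    calc (N' + 3)! + 1 = (N' + 3) * ((N' + 2) * ((N' + 1) * N' !)) + 1 := by rw [hexp]
      _ ≤ (2 * (1 + H)) * ((2 * (1 + H)) * ((2 * (1 + H)) * H)) + 1 := by gcongr <;> omega
      _ ≤ 8 * (1 + H) ^ 4 := by nlinarith [hcube]
      _ ≤ (1 + H) ^ 3 * (1 + H) ^ 4 := Nat.mul_le_mul_right _ h8
      _ = (1 + H) ^ 7 := by rw [← pow_add]
      _ ≤ (1 + H) ^ 13 := Nat.pow_le_pow_right (by omega) (by norm_num)

/-- **(M) THE ONE-CUT 2-ADIC FORM BOUND** — the quantitative opposite of `HyperLinLiouville` at the fixed-finite-order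
Liouville coordinate `ρ♮₂`: for every integer vector `g ≠ 0`,
`exp(−(1+Σ|gᵢ|)^13) ≤ |g₀ + g₁ℓ₂ + g₂ρ♮₂|`.  With `H = Σ|gᵢ|` and `K` the LEAST scale with `H < 2^{f_K}`, cut BOTH series at
the single resolution `F = (N_K+1)!`: `2^F·(g₀ + g₁ s_{N_K+1} + g₂ t_K) = I_K(g)` is a NON-ZERO integer (`cutInt_ne_zero_of_small`:
2-adic divisibility, `p_{N_K+1}`, `M_K` odd, `|g₁| < 2^{F−f_K}`, `|g₂| < 2^{f_K}`), the truncation error is `≤ 1/(2·2^F)` by the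
slacks `(N_K+2)! ≥ f_K + F + 3`, `g_K ≥ f_K + F + 3` (`cut_slack_ell`, `cut_slack_rho`), so `|φ(g)| ≥ 1/2^{F+1}`, and minimality
gives `F + 1 ≤ (1+H)^{13}` (`cut_height_bound`; `log 2 ≤ 1`). -/
theorem form_lower_bound_N (g : Fin 3 → ℤ) (hg : g ≠ 0) :
    Real.exp (-((1 + ∑ i, (|g i| : ℝ)) ^ 13)) ≤
      |(g 0 : ℝ) + g 1 * liouvilleNumber 2 + g 2 * rhoNat 2| := by
  classical
  set HR : ℝ := ∑ i, (|g i| : ℝ) with hHR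
  set Hn : ℕ := ∑ i, (g i).natAbs with hHn
  have hHRn : HR = (Hn : ℝ) := by
    rw [hHR, hHn, Nat.cast_sum]
    refine Finset.sum_congr rfl fun i _ => ?_
    simp only [Nat.cast_natAbs, Int.cast_abs]
  have hgi : ∀ i, (g i).natAbs ≤ Hn := fun i =>
    Finset.single_le_sum (f := fun i => (g i).natAbs) (fun _ _ => Nat.zero_le _) (Finset.mem_univ i)
  have hHn1 : 1 ≤ Hn := by
    obtain ⟨i, hi⟩ := Function.ne_iff.mp hg
    have hi' : g i ≠ 0 := by simpa using hi
    exact le_trans (Nat.one_le_iff_ne_zero.mpr (Int.natAbs_ne_zero.mpr hi')) (hgi i)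
  -- the scale: `K` least with `Hn < 2^{f_K}`
  have hex : ∃ K : ℕ, Hn < 2 ^ fN 2 K := by
    refine ⟨Hn, Nat.lt_two_pow_self.trans_le (Nat.pow_le_pow_right (by norm_num) ?_)⟩
    exact le_trans (le_trans (Nat.le_mul_of_pos_left Hn two_pos) (two_mul_le_Nn 2 Hn)) (Nn_le_fN 2 Hn)
  set K : ℕ := Nat.find hex with hK
  have hKspec : Hn < 2 ^ fN 2 K := Nat.find_spec hex
  have hKmin : ∀ k < K, 2 ^ fN 2 k ≤ Hn := fun k hk => not_lt.mp (Nat.find_min hex hk)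
  set N : ℕ := Nn 2 K with hN
  set F : ℕ := (N + 1)! with hF
  -- `|g₁|, |g₂| ≤ Hn < 2^{f_K}`
  have hsmall : ∀ i, |g i| < 2 ^ fN 2 K := fun i => by
    have h1 : (((g i).natAbs : ℕ) : ℤ) < 2 ^ fN 2 K := by exact_mod_cast (hgi i).trans_lt hKspec
    rwa [Int.natCast_natAbs] at h1
  have hI : cutInt g K ≠ 0 := cutInt_ne_zero_of_small g K hg (hsmall 1) (hsmall 2)
  have hlow := cut_lower g K hI
  have happ := cut_approx g K
  -- the truncation error is at most half the resolution
  have hs1 : fN 2 K + F + 3 ≤ (N + 1 + 1)! := cut_slack_ell 2 K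
  have hs2 : fN 2 K + F + 3 ≤ gN 2 K := cut_slack_rho (le_refl 2) K
  have hgiR : ∀ i, |(g i : ℝ)| ≤ (Hn : ℝ) := fun i => by
    have h1 : (((g i).natAbs : ℕ) : ℝ) ≤ Hn := by exact_mod_cast hgi i
    rwa [Nat.cast_natAbs, Int.cast_abs] at h1
  have hHnR : (Hn : ℝ) ≤ (2 : ℝ) ^ fN 2 K := by exact_mod_cast hKspec.le
  have heps : |(g 1 : ℝ)| * (2 / (2 : ℝ) ^ (N + 1 + 1)!) + |(g 2 : ℝ)| * (2 / (2 : ℝ) ^ gN 2 K) ≤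
      1 / (2 : ℝ) ^ F / 2 := by
    have b1 : (2 : ℝ) / 2 ^ (N + 1 + 1)! ≤ 2 / 2 ^ (fN 2 K + F + 3) :=
      div_le_div_of_nonneg_left (by norm_num) (by positivity) (pow_le_pow_right₀ (by norm_num) hs1)
    have b2 : (2 : ℝ) / 2 ^ gN 2 K ≤ 2 / 2 ^ (fN 2 K + F + 3) :=
      div_le_div_of_nonneg_left (by norm_num) (by positivity) (pow_le_pow_right₀ (by norm_num) hs2)
    have hsplit : (2 : ℝ) ^ (fN 2 K + F + 3) = 2 ^ fN 2 K * 2 ^ F * 8 := by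
      rw [pow_add, pow_add]; norm_num
    calc |(g 1 : ℝ)| * (2 / (2 : ℝ) ^ (N + 1 + 1)!) + |(g 2 : ℝ)| * (2 / (2 : ℝ) ^ gN 2 K)
        ≤ (Hn : ℝ) * (2 / 2 ^ (fN 2 K + F + 3)) + (Hn : ℝ) * (2 / 2 ^ (fN 2 K + F + 3)) := by
          gcongr
          · exact hgiR 1
          · exact hgiR 2
      _ = (Hn : ℝ) * 4 / (2 ^ fN 2 K * 2 ^ F * 8) := by rw [← hsplit]; ring
      _ ≤ 2 ^ fN 2 K * 4 / (2 ^ fN 2 K * 2 ^ F * 8) := by gcongr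
      _ = 1 / (2 : ℝ) ^ F / 2 := by field_simp; ring
  -- `|φ(g)| ≥ 1/2^{F+1}`
  set frm : ℝ := (g 0 : ℝ) + g 1 * liouvilleNumber 2 + g 2 * rhoNat 2 with hfrm
  set Φ : ℝ := (g 0 : ℝ) + g 1 * partialSum 2 (N + 1) + g 2 * ((tN 2 K : ℚ) : ℝ) with hΦ
  have hfrm_low : 1 / (2 : ℝ) ^ F / 2 ≤ |frm| := by
    have h1 : |Φ| - |frm - Φ| ≤ |frm| := by
      have := abs_sub_abs_le_abs_sub Φ frm
      rw [abs_sub_comm Φ frm] at this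
      linarith
    linarith [hlow, happ.trans heps]
  -- the exponent: `F + 1 ≤ (1+H)^13`, `log 2 ≤ 1`
  have h13 : F + 1 ≤ (1 + Hn) ^ 13 := cut_height_bound hHn1 hKmin
  have hgoal : Real.exp (-((1 + HR) ^ 13)) ≤ 1 / (2 : ℝ) ^ F / 2 := by
    have hE : ((F : ℝ) + 1) ≤ (1 + HR) ^ 13 := by rw [hHRn]; exact_mod_cast h13
    have hlog2 : Real.log 2 ≤ 1 := by have := Real.log_two_lt_d9; linarith
    have e1 : 1 / (2 : ℝ) ^ F / 2 = Real.exp (-(((F + 1 : ℕ) : ℝ) * Real.log 2)) := by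
      rw [Real.exp_neg, Real.exp_nat_mul, Real.exp_log two_pos, pow_succ]
      field_simp
    rw [e1, Real.exp_le_exp, neg_le_neg_iff]
    push_cast
    calc ((F : ℝ) + 1) * Real.log 2 ≤ ((F : ℝ) + 1) * 1 := mul_le_mul_of_nonneg_left hlog2 (by positivity)
      _ ≤ (1 + HR) ^ 13 := by rw [mul_one]; exact hE
  exact hgoal.trans hfrm_low

end Members

end Summit.Schanuel.Schanuel.Theorems.RootDecomp1KCollarWall

end
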